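import Literature.NumberTheory.EllipticCurves.Kato2004.DivisibilityInputsFine
import Literature.NumberTheory.EllipticCurves.Kato2004.DivisibilityInputsMultiplicativeFine
import Literature.NumberTheory.EllipticCurves.Kato2004.DivisibilityInputsZetaLine
import HarnessLib

/-!
# Kato 2004 (Astérisque 295), §17.13 (17.13.1)–(17.13.4) with (14.9.3): the §17.13 ∃-packages on the
# pinned `(𝐇¹_Γ(T_pW), X(E/ℚ_∞))` — PRINT-EXACT twins, the dual Selmer data carrying their
# CONTRAGREDIENT `Λ`-structure (`D : W.SelmerDualData κ γ⁻¹`, `Y : W.FineSelmerDualData κ γ⁻¹` against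
# the unchanged `I : Kato2004.IwasawaH1Data W p κ γ`)

Topic `NumberTheory/EllipticCurves`, sub-directory `Kato2004` (namespace = path). Sibling of
`DivisibilityInputs` / `DivisibilityInputsFine` (cell `bsd-smallim`), `DivisibilityInputsMultiplicative` /
`DivisibilityInputsMultiplicativeFine` (cells `bsd-2adic`, `bsd-stepL`), `EulerSystemClasses` (span clause) and
`DivisibilityInputsZetaLine` (cell `bsd-print-x9`), whose three hypothesis structures and seven construction
facts it twins. THIS FILE: three hypothesis STRUCTURES (`DivisibilityInputsContra`, `MultDivisibilityInputsContra`,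
`DivisibilityInputsZetaLineContra`) — the siblings' structures FIELD FOR FIELD (names, types, docstrings),
with the ONE change that the dual Selmer datum parameter is `D : W.SelmerDualData κ γ⁻¹` —, seven named
CONSTRUCTION facts (`def … : Prop`, D-0014; nothing asserted, no `_holds`) = the siblings' facts VERBATIM with
`D : W.SelmerDualData κ γ⁻¹` and, in the fine-quotient clauses, `Y : W.FineSelmerDualData κ γ⁻¹`, and the
`ZetaLine → plain` port (`DivisibilityInputsZetaLineContra.toContra`, the sibling's `toDivisibilityInputs`,
re-using the sibling's generic `imageLocalized_of_zetaLine`), plus the proved fine-quotient ports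
`exists_divisibilityInputs_fineQuotient_contra_of_zeta` / `…_contra_of_zetaLine` (twins of the siblings'
`…_fineQuotient_of_zeta` / `…_fineQuotient_of_zetaLine`; appended 2026-08-28 by the ARM-P row-2 reader, evidence
`pub/bsd-cited/sheets/D-AUDIT-r02-ADDENDUM-9.md` (iv)). No instance beyond the structures' bundled
fields, no notation, no attribute removed. Typed by a Literature typer (cell `bsd-stepL`, guest service) on
ticket **T-ι-TWINS-1** of the ARM-P register (cell `bsd-cited`, RULING (650)/(651), RELAY 47, 2026-08-28;
evidence `pub/bsd-cited/sheets/D-AUDIT-r02-ADDENDUM-8.md` §1 and `D-AUDIT-r02-IOTA-CENSUS-1.md`). HONEST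
FRAMING: TRANSCRIPTIONS; nothing of Kato is proved here; BSD is not proved by any of this; nothing is booked.

## The point (reading flag `Kato-1713-dual-action`; the same derivation as `Kato-134-dual-action` of
## `Kato2004/EulerSystemBoundFineSelmerTwoContragredient.lean`, whose module docstring quotes Kato verbatim)

Kato's (17.13.1) [p. 279], `0 → 𝐇¹(T(k))/… → 𝐇¹_loc(T(k))/… → X(T^*(1 − k)) → 𝐇²(T(k)) → 𝐇²_loc(T(k))`, is
"a sequence of `Λ`-modules" obtained "by taking `lim←_n` of the sequence (14.9.3)" (Poitou–Tate); `𝐇¹`,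
`𝐇¹_loc`, `𝐇²`, `𝐇²_loc` carry the natural (covariant) action of `G_∞` [§12.2, p. 220], and
`X(T) = Hom_{O_λ}(Sel_∞(T), F_λ/O_λ)` is regarded "as a module over `Λ` in the natural way" [§17.3, p. 273]
— the way for which (17.13.1) IS `Λ`-linear. The duality pairings are functorial in the pair (Galois
group, module), hence invariant under transport of structure by `σ ∈ Gal(ℚ̄/ℚ)`, so the Poitou–Tate maps
intertwine the natural action with the CONTRAGREDIENT action `x ↦ x ∘ conj_{σ⁻¹}` on Pontryagin duals. The
tree pins `𝐇¹` as `I : Kato2004.IwasawaH1Data W p κ γ` with `T = conj_γ − 1`, covariant, `1 + T ↦ γ`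
(`IwasawaH1Data.proj_T_smul`), and the dual Selmer data `W.SelmerDualData κ γ'` / `W.FineSelmerDualData κ γ'`
with `T` acting by PRE-composition with `conj_{γ'}` (`SelmerDualData.toDual_T_smul`,
`FineSelmerDualData.toDual_T_smul`), i.e. by the contragredient action of `γ'⁻¹`. Hence, with `1 + T ↦ γ`
on both sides, the packages whose crossing maps `toX : P → D.X`, `δ : D.X → H2` (and `π : D.X → Y.X`) are
`Λ`-LINEAR and whose Euler-system bound `es_bound` compares `ℓ_𝔭(H2)` with `ℓ_𝔭(I.H ⧸ Z)` at the SAME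
`𝔭`, exactly as printed, are those with `D : W.SelmerDualData κ γ⁻¹` (and `Y : W.FineSelmerDualData κ γ⁻¹`)
— the structures and facts below. The siblings take `γ` there (Greenberg's `X^ι`, "the `Λ`-module with
the same underlying set … but with `Λ` acting through `ι`", `ι(γ) = γ⁻¹` [Greenberg1989, pp. 101–102]):
for them every placement of the abstract middle modules leaves one crossing link satisfiable from print
only under an unprinted `ι`-symmetry (of `char(𝐇¹/Z)` off `p`, or of the Coleman cokernel) — the ARM-P
words «STRONGER-THAN-PRINT-BY-ι as packages» (R-48). The siblings are NOT edited (D-0014: a fact's meaning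
is never changed in place; their consumers are untouched); the END roads are ι-safe by the register's
account (μ is `ι`-invariant; the divisibility roads use the printed functional equation), and are re-keyed
by their owners with a `γ ↦ γ⁻¹` twist lemma — not here.

## What is NOT here (and why)

* NO edit of any sibling; NO claim that a sibling structure/fact and its twin are equivalent; NO twist
  lemma (`exists_twist_selmerDualData_invol`, ticket T-TWIST-SEL-1, prover/API lane); NO functional
  equation of `L_p` (ticket T-FE-MTT-1); NO `_holds` (Kato §§12–17: size XL).
* The `p = 2` multiplicative targets and every «NOT here» item of the siblings.
-- TODO(general form): as in the siblings (newforms of weight `k ≥ 2`; all `Δ`-components).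

## Source, verbatim (K. Kato, Astérisque 295 (2004), held copy `paper:url-37fbba0bb64a`, PDF page =
## printed page − 115; the siblings' module docstrings quote Thm. 12.4–12.6, 16.6, 17.11, §17.13 in full)

§12.2 (p. 220): "`𝐇¹(T)` and `𝐇²(T)` are finitely generated `ℤ_p[[G_∞]]`-modules." §14.9 (p. 239): "By the
duality theory of Poitou-Tate [Ta1, Ma2], we have sequences of `O_L`-modules (14.9.1) […] (`T^* =
Hom_{O_L}(T, O_L)` endowed with the dual action of `Gal(K̄/K)`, and `{ }^∨ = Hom_{O_L}( , L/O_L)`), which are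
exact in the case `p ≠ 2`, and exact upto `×2` in the case `p = 2`." §17.3 (p. 273): "`X(T) =
Hom_{O_λ}(Sel_∞(T), F_λ/O_λ)`. We regard `X(T)` as a module over `Λ = O_λ[[G_∞]]` in the natural way."
§17.13 (p. 279): "By taking `lim←_n` of the sequence (14.9.3) for `K = ℚ(ζ_{p^n})` […] we obtain a sequence
of `Λ`-modules (17.13.1) `0 → 𝐇¹(T(k))/… → 𝐇¹_loc(T(k))/… → X(T^*(1 − k)) → 𝐇²(T(k)) → 𝐇²_loc(T(k))`
[…] which is exact if `p ≠ 2`, and is exact upto `×2` in the case `p = 2`." R. Greenberg, Adv. Stud. Pure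
Math. 17 (1989), pp. 101–102: "If `S` is any `Λ`-module, we define `S^ι` as the `Λ`-module with the same
underlying set as `S` but with `Λ` acting through `ι`."

References: [Kato2004Asterisque] §12.2 (p. 220), Thm. 12.4–12.6 (pp. 221–222), Ex. 13.3 (p. 225), §14.9
(pp. 239–240), §16 (pp. 268–271), §17.3 (p. 273), 17.5 (p. 274), Prop. 17.11 / Lemma 17.12 (pp. 277–278),
§17.13 (pp. 279–280); [Greenberg1989] pp. 101–102; [GreenbergLNM1716] §2; [Wuthrich2014] p. 391, Cor. 19;
[Kobayashi2006DocMath] Thm. 4.1; [GreenbergVatsal2000] §3; [MazurTateTeitelbaum1986] §I.10, §I.14; tree: the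
six sibling files named above, `Kato2004/IwasawaCohomology.lean` (`IwasawaH1Data.proj_T_smul`),
`IwasawaSelmer.lean` (`SelmerDualData.toDual_T_smul`), `KatoFineSelmerDual.lean`, `IwasawaAlgebraInvolution.lean`.
-/

noncomputable section

open scoped MatrixGroups ModularForm NumberField
open Field CongruenceSubgroup
open Literature.NumberTheory.GaloisRepresentations
open Literature.NumberTheory.EllipticCurves Literature.NumberTheory.EllipticCurves.ModularForms
open Literature.NumberTheory.EllipticCurves.Kato2004.EulerSystemValues

namespace Literature.NumberTheory.EllipticCurves.Kato2004

open Module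

/-! ## §1 The good-ordinary package (twin of `DivisibilityInputs`) and its three facts -/

section Package

variable (W : WeierstrassCurve ℚ) [W.IsElliptic] [W.IsGloballyMinimal] (p : ℕ) [Fact p.Prime]
  [ContinuousSMul ℤ_[p] (W.tateModule p)] {N : ℕ} [NeZero N] (f : CuspForm (Gamma0 N) 2)
  (κ : ZpExtension ℚ p) (γ : absoluteGaloisGroup ℚ)
  (I : IwasawaH1Data W p κ γ) (D : W.SelmerDualData κ γ⁻¹)

/-- **Kato's §17.13 inputs on `(𝐇¹_Γ(T_pW), X(E/ℚ_∞))` — PRINT-EXACT twin of `Kato2004.DivisibilityInputs`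
(hypothesis structure; nothing asserted).** FIELD FOR FIELD the sibling `DivisibilityInputs W p f κ γ I D`
(its field docstrings apply verbatim: (12.2.1) + Thm. 12.4 (1); the maps `loc, toX, δ, ε` of (17.13.1) with
(17.13.2)/(17.13.3) and exactness for `p ≠ 2`; (17.13.4); Prop. 17.11 (`col`); Thm. 12.6 (`Z`); 16.6 (2) with
12.5 (1)(2), 12.6 (`pow_mem`); Thm. 12.5 (3) at `𝔭 ∌ p` (`es_bound`, SAME `𝔭` on both sides); Thm. 12.5 (4)
with 17.4 (3) (`integral`); p. 280 (`image_zeta_localized`)), for the pinned `I : IwasawaH1Data W p κ γ`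
(`T = conj_γ − 1`, covariant, `1 + T ↦ γ`) and a dual Selmer datum `D : W.SelmerDualData κ γ⁻¹`
(`X(E/ℚ_∞)` with `T` acting as `x ↦ x ∘ conj_{γ⁻¹} − x`, the CONTRAGREDIENT structure — the one for which
the Poitou–Tate maps `P → X → 𝐇²` of (17.13.1) are `Λ`-linear as printed; flag `Kato-1713-dual-action`).
[cite: Kato2004Asterisque, Thm. 12.4 (1) (p. 221), Thm. 12.5 (2)–(4) (p. 222), Thm. 12.6 (p. 222), Thm. 16.6 (p. 271), Prop. 17.11 (p. 277), §17.3 (p. 273), §17.13 (17.13.1)–(17.13.4) and p. 280 (pp. 279–280), §14.9 (p. 239)]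
[cite: Greenberg1989, §0 pp. 101–102 (the Λ-module S^ι, ι(γ) = γ⁻¹)] -/
structure DivisibilityInputsContra where
  /-- `P = 𝐇¹_loc(T(k))/𝐇¹_loc(T'(k))` ((17.13.3)), abstract. -/
  P : Type
  /-- `H2 = 𝐇²(T(k))` (`Δ`-trivial component), abstract. -/
  H2 : Type
  /-- `H2loc = 𝐇²_loc(T(k))`, abstract. -/
  H2loc : Type
  [addCommGroupP : AddCommGroup P]
  [moduleP : _root_.Module (IwasawaAlgebra p) P]
  [addCommGroupH2 : AddCommGroup H2]
  [moduleH2 : _root_.Module (IwasawaAlgebra p) H2]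
  [addCommGroupH2loc : AddCommGroup H2loc]
  [moduleH2loc : _root_.Module (IwasawaAlgebra p) H2loc]
  /-- (12.2.1): `𝐇²` is a finitely generated `Λ`-module. -/
  finite_H2 : Module.Finite (IwasawaAlgebra p) H2
  /-- Thm. 12.4 (1): `𝐇²` is a torsion `Λ`-module. -/
  isTorsion_H2 : Module.IsTorsion (IwasawaAlgebra p) H2
  /-- (17.13.1): `𝐇¹ → P` (localisation at `p` followed by the quotient by `𝐇¹_loc(T')`). -/
  loc : I.H →ₗ[IwasawaAlgebra p] P
  /-- (17.13.1): `P → 𝔛 = X(E/ℚ_∞)` (contragredient `Λ`-structure on the dual). -/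
  toX : P →ₗ[IwasawaAlgebra p] D.X
  /-- (17.13.1): `𝔛 → 𝐇²`. -/
  δ : D.X →ₗ[IwasawaAlgebra p] H2
  /-- (17.13.1): `𝐇² → 𝐇²_loc`. -/
  ε : H2 →ₗ[IwasawaAlgebra p] H2loc
  /-- (17.13.2) (`lim← H¹_f(ℤ[ζ_{p^n},1/p], T(r)) = 0`, p. 279): `𝐇¹ → P` is injective. -/
  loc_injective : Function.Injective loc
  /-- (17.13.1) with (17.13.3), `p ≠ 2`: exactness at `P`. -/
  exact_P : Function.Exact loc toX
  /-- (17.13.1), `p ≠ 2`: exactness at `𝔛`. -/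
  exact_X : Function.Exact toX δ
  /-- (17.13.1), `p ≠ 2`: exactness at `𝐇²`. -/
  exact_H2 : Function.Exact δ ε
  /-- (17.13.4) (latter half of Thm. 12.5 (3); `f` potentially good at `p`): `𝐇²_loc` is finite. -/
  finite_H2loc : Finite H2loc
  /-- Prop. 17.11: the Coleman map `𝔏_η` induces an injection `P ↪ Λ` … -/
  col : P →ₗ[IwasawaAlgebra p] IwasawaAlgebra p
  /-- Prop. 17.11: … which is injective … -/
  col_injective : Function.Injective col
  /-- Prop. 17.11: … with finite cokernel. -/
  finite_coker_col : Finite (IwasawaAlgebra p ⧸ LinearMap.range col)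
  /-- Thm. 12.6: the `Λ`-span `Z ⊂ 𝐇¹(T)` of the integral zeta elements (8.1.3)/(8.11) (all admissible
  `c, d, j, a(A)` resp. `α`), projected to the `Δ`-trivial component. -/
  Z : Submodule (IwasawaAlgebra p) I.H
  /-- The `p`-power denominator of 17.4 (2) "`L_{p-adic} ∈ Λ ⊗ ℚ`" (p. 279: from 17.11 and 16.6). -/
  n : ℕ
  /-- `G = p^n · L_p(E,T)` as an element of `Λ`. -/
  G : IwasawaAlgebra p
  /-- `ι G = p^n · L_p(E,T)` in `ℚ_p⟦T⟧` (17.4 (2), p. 279). -/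
  ιG_eq : iwasawaToPowerSeries p G =
    PowerSeries.C ((p : ℚ_[p]) ^ n) * padicLFunction f (unitRoot W p : ℚ_[p])
  /-- Thm. 16.6 (2) with 12.5 (1) and 12.6 (`p^m Z(f,T) ⊂ Z`): `G ∈ col(loc Z)`. -/
  pow_mem : G ∈ Submodule.map (col ∘ₗ loc) Z
  /-- Thm. 12.5 (3) (via Thm. 13.4 (2)) at the height-one primes `𝔭 ∌ p`, printed shape:
  `length 𝐇²_𝔭 ≤ length (𝐇¹/Z)_𝔭 + length (𝐇²_loc)_𝔭` (`Z(f)_𝔭 = Z_𝔭` there), SAME `𝔭` both sides. -/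
  es_bound : ∀ 𝔭 : PrimeSpectrum (IwasawaAlgebra p), 𝔭.asIdeal.height = 1 →
    PowerSeries.C (p : ℤ_[p]) ∉ 𝔭.asIdeal →
      lengthAt (IwasawaAlgebra p) H2 𝔭 ≤
        lengthAt (IwasawaAlgebra p) (I.H ⧸ Z) 𝔭 + lengthAt (IwasawaAlgebra p) H2loc 𝔭
  /-- Thm. 12.5 (4) with 17.4 (3) (p. 279 "`L ∈ Λ`"), under the surjectivity hypothesis of
  `kato_divisibility` (3): the integral zeta submodule `Z' = Z(f,T) ⊂ 𝐇¹` with `L_p = ι G' ∈ col(loc Z')`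
  and the inequality at EVERY height-one prime. -/
  integral : (∀ m : ℕ, W.HasSurjectiveModNGaloisRep (p ^ m : ℕ)) →
    ∃ (Z' : Submodule (IwasawaAlgebra p) I.H) (G' : IwasawaAlgebra p),
      G' ∈ Submodule.map (col ∘ₗ loc) Z' ∧
      iwasawaToPowerSeries p G' = padicLFunction f (unitRoot W p : ℚ_[p]) ∧
      ∀ 𝔭 : PrimeSpectrum (IwasawaAlgebra p), 𝔭.asIdeal.height = 1 →
        lengthAt (IwasawaAlgebra p) H2 𝔭 ≤ lengthAt (IwasawaAlgebra p) (I.H ⧸ Z') 𝔭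
  /-- p. 280 with 17.11, 16.6, 12.5 (1)(2), 12.6 and 17.5: under `Irr(E[p])`, for `G₁ ∈ Λ` with
  `ι G₁ = L_p(E,T)`, the submodules `col(loc Z)` and `Λ·G₁` of `Λ` agree after localisation at EVERY
  height-one prime `𝔭`: some `s ∉ 𝔭` multiplies each into the other (as in the sibling; no (12.5.2)). -/
  image_zeta_localized : W.HasIrreducibleModPGaloisRep p → ∀ G₁ : IwasawaAlgebra p,
    iwasawaToPowerSeries p G₁ = padicLFunction f (unitRoot W p : ℚ_[p]) →
      ∀ 𝔭 : PrimeSpectrum (IwasawaAlgebra p), 𝔭.asIdeal.height = 1 →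
        ∃ s : IwasawaAlgebra p, s ∉ 𝔭.asIdeal ∧
          s * G₁ ∈ Submodule.map (col ∘ₗ loc) Z ∧
          ∀ z ∈ Z, s * col (loc z) ∈ Ideal.span {G₁}

attribute [instance] DivisibilityInputsContra.addCommGroupP DivisibilityInputsContra.moduleP
  DivisibilityInputsContra.addCommGroupH2 DivisibilityInputsContra.moduleH2
  DivisibilityInputsContra.addCommGroupH2loc DivisibilityInputsContra.moduleH2loc

/-- **The §17.13 package with the zeta line — PRINT-EXACT twin of `Kato2004.DivisibilityInputsZetaLine`
(hypothesis structure; nothing asserted).** FIELD FOR FIELD the sibling (fields `P … integral` as in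
`DivisibilityInputsContra` above; in place of `image_zeta_localized` the two integral shadows (F1b)
`col_loc_mem_span` and (F1a) `exists_zetaLine` of the sibling, verbatim — they involve `𝐇¹`, `P` and `Λ`
only), for `I : IwasawaH1Data W p κ γ` and a dual Selmer datum `D : W.SelmerDualData κ γ⁻¹` (contragredient
`Λ`-structure; flag `Kato-1713-dual-action`). The old-style field is the theorem
`DivisibilityInputsZetaLineContra.image_zeta_localized`; the plain package is `toContra`.
[cite: Kato2004Asterisque, Thm. 12.4 (1) (p. 221), Thm. 12.5 (1)–(4) (pp. 221–222), Thm. 12.6 (p. 222), Thm. 16.6 (p. 271), Thm. 17.4 (2) (p. 273), 17.5 (p. 274), Prop. 17.11 (p. 277), §17.3 (p. 273), §17.13 (17.13.1)–(17.13.4) and p. 280 (pp. 279–280)]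
[cite: GreenbergVatsal2000, §3 Remark 3.4 and Prop. 3.7] [cite: Greenberg1989, §0 pp. 101–102 (S^ι)] -/
structure DivisibilityInputsZetaLineContra where
  /-- `P = 𝐇¹_loc(T(k))/𝐇¹_loc(T'(k))` ((17.13.3)), abstract. -/
  P : Type
  /-- `H2 = 𝐇²(T(k))` (`Δ`-trivial component), abstract. -/
  H2 : Type
  /-- `H2loc = 𝐇²_loc(T(k))`, abstract. -/
  H2loc : Type
  [addCommGroupP : AddCommGroup P]
  [moduleP : _root_.Module (IwasawaAlgebra p) P]
  [addCommGroupH2 : AddCommGroup H2]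
  [moduleH2 : _root_.Module (IwasawaAlgebra p) H2]
  [addCommGroupH2loc : AddCommGroup H2loc]
  [moduleH2loc : _root_.Module (IwasawaAlgebra p) H2loc]
  /-- (12.2.1): `𝐇²` is a finitely generated `Λ`-module. -/
  finite_H2 : Module.Finite (IwasawaAlgebra p) H2
  /-- Thm. 12.4 (1): `𝐇²` is a torsion `Λ`-module. -/
  isTorsion_H2 : Module.IsTorsion (IwasawaAlgebra p) H2
  /-- (17.13.1): `𝐇¹ → P`. -/
  loc : I.H →ₗ[IwasawaAlgebra p] P
  /-- (17.13.1): `P → 𝔛 = X(E/ℚ_∞)` (contragredient `Λ`-structure on the dual). -/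
  toX : P →ₗ[IwasawaAlgebra p] D.X
  /-- (17.13.1): `𝔛 → 𝐇²`. -/
  δ : D.X →ₗ[IwasawaAlgebra p] H2
  /-- (17.13.1): `𝐇² → 𝐇²_loc`. -/
  ε : H2 →ₗ[IwasawaAlgebra p] H2loc
  /-- (17.13.2): `𝐇¹ → P` is injective. -/
  loc_injective : Function.Injective loc
  /-- (17.13.1) with (17.13.3), `p ≠ 2`: exactness at `P`. -/
  exact_P : Function.Exact loc toX
  /-- (17.13.1), `p ≠ 2`: exactness at `𝔛`. -/
  exact_X : Function.Exact toX δ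
  /-- (17.13.1), `p ≠ 2`: exactness at `𝐇²`. -/
  exact_H2 : Function.Exact δ ε
  /-- (17.13.4): `𝐇²_loc` is finite. -/
  finite_H2loc : Finite H2loc
  /-- Prop. 17.11: the Coleman map `P ↪ Λ` … -/
  col : P →ₗ[IwasawaAlgebra p] IwasawaAlgebra p
  /-- Prop. 17.11: … injective … -/
  col_injective : Function.Injective col
  /-- Prop. 17.11: … with finite cokernel. -/
  finite_coker_col : Finite (IwasawaAlgebra p ⧸ LinearMap.range col)
  /-- Thm. 12.6: the `Λ`-span `Z ⊂ 𝐇¹(T)` of the integral zeta elements. -/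
  Z : Submodule (IwasawaAlgebra p) I.H
  /-- The `p`-power denominator of 17.4 (2). -/
  n : ℕ
  /-- `G = p^n · L_p(E,T)` as an element of `Λ`. -/
  G : IwasawaAlgebra p
  /-- `ι G = p^n · L_p(E,T)` in `ℚ_p⟦T⟧`. -/
  ιG_eq : iwasawaToPowerSeries p G =
    PowerSeries.C ((p : ℚ_[p]) ^ n) * padicLFunction f (unitRoot W p : ℚ_[p])
  /-- Thm. 16.6 (2) with 12.5 (1) and 12.6: `G ∈ col(loc Z)`. -/
  pow_mem : G ∈ Submodule.map (col ∘ₗ loc) Z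
  /-- Thm. 12.5 (3) at the height-one primes `𝔭 ∌ p`, printed shape, SAME `𝔭` both sides. -/
  es_bound : ∀ 𝔭 : PrimeSpectrum (IwasawaAlgebra p), 𝔭.asIdeal.height = 1 →
    PowerSeries.C (p : ℤ_[p]) ∉ 𝔭.asIdeal →
      lengthAt (IwasawaAlgebra p) H2 𝔭 ≤
        lengthAt (IwasawaAlgebra p) (I.H ⧸ Z) 𝔭 + lengthAt (IwasawaAlgebra p) H2loc 𝔭
  /-- Thm. 12.5 (4) with 17.4 (3) under the surjectivity hypothesis of `kato_divisibility` (3). -/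
  integral : (∀ m : ℕ, W.HasSurjectiveModNGaloisRep (p ^ m : ℕ)) →
    ∃ (Z' : Submodule (IwasawaAlgebra p) I.H) (G' : IwasawaAlgebra p),
      G' ∈ Submodule.map (col ∘ₗ loc) Z' ∧
      iwasawaToPowerSeries p G' = padicLFunction f (unitRoot W p : ℚ_[p]) ∧
      ∀ 𝔭 : PrimeSpectrum (IwasawaAlgebra p), 𝔭.asIdeal.height = 1 →
        lengthAt (IwasawaAlgebra p) H2 𝔭 ≤ lengthAt (IwasawaAlgebra p) (I.H ⧸ Z') 𝔭
  /-- (F1b) as in the sibling: under `Irr(E[p])`, for `G₁ ∈ Λ` with `ι G₁ = L_p(E,T)`,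
  `col(loc z) ∈ Λ·G₁` for every `z ∈ Z`. -/
  col_loc_mem_span : W.HasIrreducibleModPGaloisRep p → ∀ G₁ : IwasawaAlgebra p,
    iwasawaToPowerSeries p G₁ = padicLFunction f (unitRoot W p : ℚ_[p]) →
      ∀ z ∈ Z, col (loc z) ∈ Ideal.span {G₁}
  /-- (F1a) as in the sibling: the zeta line through Thm. 12.6's finite index — `m`, a unit `u`, and
  `wp, wT ∈ Z` with `T^m • wp = p^m • wT`, `col(loc wp) = p^m·u·G₁`, `col(loc wT) = T^m·u·G₁`. -/
  exists_zetaLine : W.HasIrreducibleModPGaloisRep p → ∀ G₁ : IwasawaAlgebra p,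
    iwasawaToPowerSeries p G₁ = padicLFunction f (unitRoot W p : ℚ_[p]) →
      ∃ (m : ℕ) (u : (IwasawaAlgebra p)ˣ) (wp wT : I.H), wp ∈ Z ∧ wT ∈ Z ∧
        (PowerSeries.X : IwasawaAlgebra p) ^ m • wp =
          (PowerSeries.C (p : ℤ_[p]) : IwasawaAlgebra p) ^ m • wT ∧
        col (loc wp) = (PowerSeries.C (p : ℤ_[p]) : IwasawaAlgebra p) ^ m * u * G₁ ∧
        col (loc wT) = (PowerSeries.X : IwasawaAlgebra p) ^ m * u * G₁

attribute [instance] DivisibilityInputsZetaLineContra.addCommGroupP DivisibilityInputsZetaLineContra.moduleP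
  DivisibilityInputsZetaLineContra.addCommGroupH2 DivisibilityInputsZetaLineContra.moduleH2
  DivisibilityInputsZetaLineContra.addCommGroupH2loc DivisibilityInputsZetaLineContra.moduleH2loc

end Package

/-! ### The zeta-line twin yields the plain twin (port, as in the sibling) -/

section ToPlain

variable {W : WeierstrassCurve ℚ} [W.IsElliptic] [W.IsGloballyMinimal] {p : ℕ} [Fact p.Prime]
  [ContinuousSMul ℤ_[p] (W.tateModule p)] {N : ℕ} {f : CuspForm (Gamma0 N) 2}
  {κ : ZpExtension ℚ p} {γ : absoluteGaloisGroup ℚ}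
  {I : IwasawaH1Data W p κ γ} {D : W.SelmerDualData κ γ⁻¹}

/-- The field `image_zeta_localized` of the plain twin is a THEOREM of the zeta-line twin, from (F1a)
and (F1b) by the sibling's generic `imageLocalized_of_zetaLine` (pure algebra in `Λ`; witnesses `T^m` at
`(p)`, `p^m` elsewhere). [cite: Kato2004Asterisque, Thm. 12.6 (p. 222), Thm. 16.6 (2) (p. 271), Prop. 17.11 (p. 277) and §17.13 (p. 280)] -/
theorem DivisibilityInputsZetaLineContra.image_zeta_localized
    (K : DivisibilityInputsZetaLineContra W p f κ γ I D) :
    W.HasIrreducibleModPGaloisRep p → ∀ G₁ : IwasawaAlgebra p,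
      iwasawaToPowerSeries p G₁ = padicLFunction f (unitRoot W p : ℚ_[p]) →
        ∀ 𝔭 : PrimeSpectrum (IwasawaAlgebra p), 𝔭.asIdeal.height = 1 →
          ∃ s : IwasawaAlgebra p, s ∉ 𝔭.asIdeal ∧
            s * G₁ ∈ Submodule.map (K.col ∘ₗ K.loc) K.Z ∧
            ∀ z ∈ K.Z, s * K.col (K.loc z) ∈ Ideal.span {G₁} := by
  intro hirr G₁ hG₁
  obtain ⟨m, u, wp, wT, hwp, hwT, -, hcwp, hcwT⟩ := K.exists_zetaLine hirr G₁ hG₁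
  exact imageLocalized_of_zetaLine K.loc K.col K.Z G₁ m u wp wT hwp hwT hcwp hcwT
    (K.col_loc_mem_span hirr G₁ hG₁)

/-- **The plain print-exact package from the zeta-line one** (every shared field carried over,
`image_zeta_localized` the theorem above) — the twin of `DivisibilityInputsZetaLine.toDivisibilityInputs`.
[cite: Kato2004Asterisque, §17.13 (pp. 279–280)] -/
def DivisibilityInputsZetaLineContra.toContra (K : DivisibilityInputsZetaLineContra W p f κ γ I D) :
    DivisibilityInputsContra W p f κ γ I D where
  P := K.P
  H2 := K.H2
  H2loc := K.H2loc
  finite_H2 := K.finite_H2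
  isTorsion_H2 := K.isTorsion_H2
  loc := K.loc
  toX := K.toX
  δ := K.δ
  ε := K.ε
  loc_injective := K.loc_injective
  exact_P := K.exact_P
  exact_X := K.exact_X
  exact_H2 := K.exact_H2
  finite_H2loc := K.finite_H2loc
  col := K.col
  col_injective := K.col_injective
  finite_coker_col := K.finite_coker_col
  Z := K.Z
  n := K.n
  G := K.G
  ιG_eq := K.ιG_eq
  pow_mem := K.pow_mem
  es_bound := K.es_bound
  integral := K.integral
  image_zeta_localized := K.image_zeta_localized

/-- `toContra` keeps `Z`. [cite: Kato2004Asterisque, Thm. 12.6 (p. 222)] -/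
@[simp] theorem DivisibilityInputsZetaLineContra.toContra_Z
    (K : DivisibilityInputsZetaLineContra W p f κ γ I D) : K.toContra.Z = K.Z := rfl

/-- `toContra` keeps `toX`. [cite: Kato2004Asterisque, §17.13 (17.13.1) (p. 279)] -/
@[simp] theorem DivisibilityInputsZetaLineContra.toContra_toX
    (K : DivisibilityInputsZetaLineContra W p f κ γ I D) : K.toContra.toX = K.toX := rfl

/-- `toContra` keeps `loc`. [cite: Kato2004Asterisque, §17.13 (17.13.1) (p. 279)] -/
@[simp] theorem DivisibilityInputsZetaLineContra.toContra_loc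
    (K : DivisibilityInputsZetaLineContra W p f κ γ I D) : K.toContra.loc = K.loc := rfl

/-- `toContra` keeps `col`. [cite: Kato2004Asterisque, Prop. 17.11 (p. 277)] -/
@[simp] theorem DivisibilityInputsZetaLineContra.toContra_col
    (K : DivisibilityInputsZetaLineContra W p f κ γ I D) : K.toContra.col = K.col := rfl

end ToPlain

/-! ### The three good-ordinary facts (twins of `exists_divisibilityInputs`,
`exists_divisibilityInputs_fineQuotient` (E114), `exists_divisibilityInputs_fineQuotient_zeta`) and the
zeta-line fact (twin of `exists_divisibilityInputsZetaLine_fineQuotient_zeta`, Q70) -/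

/-- **Kato 2004, Thm. 12.4 (1), 12.5 (2)–(4), 12.6, 16.6, 17.11 and §17.13 for `T ≅ T_pE(−1)`, `k = 2`:
the §17.13 inputs EXIST on `(𝐇¹_Γ(T_pW), X(E/ℚ_∞))` with the dual Selmer datum in its CONTRAGREDIENT
`Λ`-structure** — VERBATIM the sibling `exists_divisibilityInputs` (same binders: `W/ℚ` globally minimal,
odd good ordinary `p`, cyclotomic `κ` with topological generator `γ` matching the cyclotomic variable,
newform `f`, every `I : IwasawaH1Data W p κ γ`) except `D : W.SelmerDualData κ γ⁻¹` and the conclusion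
`Nonempty (DivisibilityInputsContra W p f κ γ I D)`. A CONSTRUCTION fact (weaker than print: `P, 𝐇²,
𝐇²_loc` forgotten), never stronger — the PRINT-EXACT twin resolving reading flag `Kato-1713-dual-action`:
the sibling (`D` over `γ`) is the printed package composed with `ι` on the dual side and keeps the flag
(ARM-P R-48); this decl: VERBATIM · PRINT-EXACT · KERNEL-LOCKED against the sibling (bsd-cited (658)/(668)).
Nothing asserted; no `_holds` (size XL).
[cite: Kato2004Asterisque, Thm. 12.4 (1) (p. 221), Thm. 12.5 (2)–(4) and Thm. 12.6 (p. 222), Thm. 16.6 (p. 271), Prop. 17.11 (p. 277), §17.3 (p. 273), §17.13 (pp. 279–280), §14.9 (p. 239)]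
[cite: Greenberg1989, §0 pp. 101–102 (S^ι)] -/
def exists_divisibilityInputs_contra : Prop :=
  ∀ (W : WeierstrassCurve ℚ) [W.IsElliptic] [W.IsGloballyMinimal] (p : ℕ) [Fact p.Prime]
    [ContinuousSMul ℤ_[p] (W.tateModule p)] {N : ℕ} [NeZero N] (f : CuspForm (Gamma0 N) 2)
    (κ : ZpExtension ℚ p) (γ : absoluteGaloisGroup ℚ),
    p ≠ 2 → IsOrdinaryAt W p → κ.IsCyclotomic → κ.IsTopGenerator γ → IsCyclotomicVariable p γ →
    IsNewformOf W f →
    ∀ (I : IwasawaH1Data W p κ γ) (D : W.SelmerDualData κ γ⁻¹),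
      Nonempty (DivisibilityInputsContra W p f κ γ I D)

/-- **Kato 2004, (14.9.3) (p. 240) and (17.13.1) (p. 279) for `T ≅ T_pE(−1)`, `k = 2`: the §17.13 package
EXISTS with the cokernel of `P → X(E/ℚ_∞)` equal to the dual fine Selmer group — BOTH duals in their
CONTRAGREDIENT `Λ`-structure (E114′).** VERBATIM the sibling `exists_divisibilityInputs_fineQuotient` (E114:
one of the named print inputs of the H1/H0 theorem `bsdp_allCurves_of_not_corner_of_not_cornerF`, consumed
by `mu_eq_zero_of_fineSelmerDual_mu_eq_zero`) except `D : W.SelmerDualData κ γ⁻¹`,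
`Y : W.FineSelmerDualData κ γ⁻¹`, and `K : DivisibilityInputsContra …`; the clause `π : D.X ↠ Y.X`
surjective and exact after `toX` (dual of `Sel₀ ⊆ Sel`) is convention-consistent (both duals
contragredient). A CONSTRUCTION fact — the PRINT-EXACT twin resolving reading flag
`Kato-1713-dual-action` (the flag and ARM-P R-48 stay on the γ-keyed sibling; this decl: VERBATIM ·
PRINT-EXACT · KERNEL-LOCKED against the sibling, bsd-cited (658)/(668)); nothing asserted; no `_holds`.
[cite: Kato2004Asterisque, (14.9.3) (p. 240), §14.1 (p. 235), §17.3 (p. 273), §17.13 (17.13.1) (p. 279) and p. 280]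
[cite: Kim2022StructureSelmer, §1.2.4] [cite: Greenberg1989, §0 pp. 101–102 (S^ι)] -/
def exists_divisibilityInputs_fineQuotient_contra : Prop :=
  ∀ (W : WeierstrassCurve ℚ) [W.IsElliptic] [W.IsGloballyMinimal] (p : ℕ) [Fact p.Prime]
    [ContinuousSMul ℤ_[p] (W.tateModule p)] {N : ℕ} [NeZero N] (f : CuspForm (Gamma0 N) 2)
    (κ : ZpExtension ℚ p) (γ : absoluteGaloisGroup ℚ),
    p ≠ 2 → IsOrdinaryAt W p → κ.IsCyclotomic → κ.IsTopGenerator γ → IsCyclotomicVariable p γ →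
    IsNewformOf W f →
    ∀ (I : IwasawaH1Data W p κ γ) (D : W.SelmerDualData κ γ⁻¹) (Y : W.FineSelmerDualData κ γ⁻¹),
      ∃ (K : DivisibilityInputsContra W p f κ γ I D) (π : D.X →ₗ[IwasawaAlgebra p] Y.X),
        Function.Surjective π ∧ Function.Exact K.toX π

/-- **Kato 2004, §17.13 package with the fine quotient AND the Thm. 12.6 span clause (`Z` inside the
`Λ`-span of GENUINE Λ-adic Euler-system classes, Ex. 13.3), duals in their CONTRAGREDIENT
`Λ`-structure.** VERBATIM the sibling `exists_divisibilityInputs_fineQuotient_zeta` (file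
`EulerSystemClasses`; same telescope as E114, included here for completeness of the class) except
`D : W.SelmerDualData κ γ⁻¹`, `Y : W.FineSelmerDualData κ γ⁻¹`, `K : DivisibilityInputsContra …`; the span
clause involves `𝐇¹` only (`IsEulerSystemClass W p κ γ I s`, unchanged). A CONSTRUCTION fact — the
PRINT-EXACT twin resolving reading flag `Kato-1713-dual-action` (the flag and ARM-P R-48
stay on the γ-keyed sibling; this decl: VERBATIM · PRINT-EXACT · KERNEL-LOCKED against the sibling,
bsd-cited (658)/(668)); nothing asserted; no `_holds`.
[cite: Kato2004Asterisque, Thm. 12.6 (p. 222), Ex. 13.3 (p. 225), (14.9.3) (p. 240), §17.3 (p. 273), §17.13 (17.13.1) (p. 279) and p. 280]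
[cite: Greenberg1989, §0 pp. 101–102 (S^ι)] -/
def exists_divisibilityInputs_fineQuotient_zeta_contra : Prop :=
  ∀ (W : WeierstrassCurve ℚ) [W.IsElliptic] [W.IsGloballyMinimal] (p : ℕ) [Fact p.Prime]
    [ContinuousSMul ℤ_[p] (W.tateModule p)] [Module.Free ℤ_[p] (W.tateModule p)]
    [Module.Finite ℤ_[p] (W.tateModule p)] {N : ℕ} [NeZero N] (f : CuspForm (Gamma0 N) 2)
    (κ : ZpExtension ℚ p) (γ : absoluteGaloisGroup ℚ),
    p ≠ 2 → IsOrdinaryAt W p → κ.IsCyclotomic → κ.IsTopGenerator γ → IsCyclotomicVariable p γ →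
    IsNewformOf W f →
    ∀ (I : IwasawaH1Data W p κ γ) (D : W.SelmerDualData κ γ⁻¹) (Y : W.FineSelmerDualData κ γ⁻¹),
      ∃ (K : DivisibilityInputsContra W p f κ γ I D) (π : D.X →ₗ[IwasawaAlgebra p] Y.X),
        Function.Surjective π ∧ Function.Exact K.toX π ∧
        K.Z ≤ Submodule.span (IwasawaAlgebra p) {s : I.H | IsEulerSystemClass W p κ γ I s}

/-- **Kato 2004, the §17.13 package WITH THE ZETA LINE, fine quotient and Thm. 12.6 span clause, duals in
their CONTRAGREDIENT `Λ`-structure (Q70′).** VERBATIM the sibling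
`exists_divisibilityInputsZetaLine_fineQuotient_zeta` except `D : W.SelmerDualData κ γ⁻¹`,
`Y : W.FineSelmerDualData κ γ⁻¹`, `K : DivisibilityInputsZetaLineContra …`. A CONSTRUCTION fact; implies the
plain twins through `toContra` — the PRINT-EXACT twin resolving reading flag
`Kato-1713-dual-action` (the flag and ARM-P R-48 stay on the γ-keyed sibling; this decl: VERBATIM ·
PRINT-EXACT · KERNEL-LOCKED against the sibling, bsd-cited (658)/(668)); nothing asserted; no `_holds`.
[cite: Kato2004Asterisque, Thm. 12.4 (1) (p. 221), Thm. 12.5 (1)–(4) (pp. 221–222), Thm. 12.6 (p. 222), Ex. 13.3 (p. 225), (14.9.3) (p. 240), Thm. 16.6 (p. 271), 17.5 (p. 274), Prop. 17.11 (p. 277), §17.3 (p. 273), §17.13 (17.13.1)–(17.13.4) (pp. 279–280)]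
[cite: GreenbergVatsal2000, §3 Remark 3.4 and Prop. 3.7] [cite: Greenberg1989, §0 pp. 101–102 (S^ι)] -/
def exists_divisibilityInputsZetaLine_fineQuotient_zeta_contra : Prop :=
  ∀ (W : WeierstrassCurve ℚ) [W.IsElliptic] [W.IsGloballyMinimal] (p : ℕ) [Fact p.Prime]
    [ContinuousSMul ℤ_[p] (W.tateModule p)] [Module.Free ℤ_[p] (W.tateModule p)]
    [Module.Finite ℤ_[p] (W.tateModule p)] {N : ℕ} [NeZero N] (f : CuspForm (Gamma0 N) 2)
    (κ : ZpExtension ℚ p) (γ : absoluteGaloisGroup ℚ),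
    p ≠ 2 → IsOrdinaryAt W p → κ.IsCyclotomic → κ.IsTopGenerator γ → IsCyclotomicVariable p γ →
    IsNewformOf W f →
    ∀ (I : IwasawaH1Data W p κ γ) (D : W.SelmerDualData κ γ⁻¹) (Y : W.FineSelmerDualData κ γ⁻¹),
      ∃ (K : DivisibilityInputsZetaLineContra W p f κ γ I D) (π : D.X →ₗ[IwasawaAlgebra p] Y.X),
        Function.Surjective π ∧ Function.Exact K.toX π ∧
        K.Z ≤ Submodule.span (IwasawaAlgebra p) {s : I.H | IsEulerSystemClass W p κ γ I s}

/-- **Q70′ ⟹ the span-clause twin** (port: `K.toContra`, same `π`, `toContra_toX`/`_Z` are `rfl`).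
[cite: Kato2004Asterisque, Thm. 12.6 (p. 222) and §17.13 (pp. 279–280)] -/
theorem exists_divisibilityInputs_fineQuotient_zeta_contra_of_zetaLine
    (h : exists_divisibilityInputsZetaLine_fineQuotient_zeta_contra) :
    exists_divisibilityInputs_fineQuotient_zeta_contra := by
  intro W _ _ p _ _ _ _ N _ f κ γ hp hord hκ hγ hγ' hf I D Y
  obtain ⟨K, π, hπs, hπ, hZ⟩ := h W p f κ γ hp hord hκ hγ hγ' hf I D Y
  exact ⟨K.toContra, π, hπs, hπ, hZ⟩

/-- **The span-clause twin ⟹ the fine-quotient twin's telescope** — VERBATIM the sibling port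
`exists_divisibilityInputs_fineQuotient_of_zeta` (file `EulerSystemClasses`) except
`D : W.SelmerDualData κ γ⁻¹`, `Y : W.FineSelmerDualData κ γ⁻¹`, `K : DivisibilityInputsContra …`: the
span-clause fact `exists_divisibilityInputs_fineQuotient_zeta_contra` implies the body of
`exists_divisibilityInputs_fineQuotient_contra` under the two extra lattice instances it carries (it only
drops a conjunct). Proved; completes the twin chain Q70′ ⟹ (span-clause twin) ⟹ (fine-quotient twin)
parallel to the siblings' Q70 ⟹ E101 ⟹ E114 ports.
[cite: Kato2004Asterisque, (14.9.3) (p. 240) and §17.13 (p. 279)] -/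
theorem exists_divisibilityInputs_fineQuotient_contra_of_zeta
    (h : exists_divisibilityInputs_fineQuotient_zeta_contra) :
    ∀ (W : WeierstrassCurve ℚ) [W.IsElliptic] [W.IsGloballyMinimal] (p : ℕ) [Fact p.Prime]
      [ContinuousSMul ℤ_[p] (W.tateModule p)] [Module.Free ℤ_[p] (W.tateModule p)]
      [Module.Finite ℤ_[p] (W.tateModule p)] {N : ℕ} [NeZero N] (f : CuspForm (Gamma0 N) 2)
      (κ : ZpExtension ℚ p) (γ : absoluteGaloisGroup ℚ),
      p ≠ 2 → IsOrdinaryAt W p → κ.IsCyclotomic → κ.IsTopGenerator γ → IsCyclotomicVariable p γ →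
      IsNewformOf W f →
      ∀ (I : IwasawaH1Data W p κ γ) (D : W.SelmerDualData κ γ⁻¹) (Y : W.FineSelmerDualData κ γ⁻¹),
        ∃ (K : DivisibilityInputsContra W p f κ γ I D) (π : D.X →ₗ[IwasawaAlgebra p] Y.X),
          Function.Surjective π ∧ Function.Exact K.toX π := by
  intro W _ _ p _ _ _ _ N _ f κ γ hp hord hκ hγ hγ' hf I D Y
  obtain ⟨K, π, hπs, hπ, -⟩ := h W p f κ γ hp hord hκ hγ hγ' hf I D Y
  exact ⟨K, π, hπs, hπ⟩

/-- **Q70′ ⟹ the fine-quotient twin's telescope** — VERBATIM the sibling port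
`exists_divisibilityInputs_fineQuotient_of_zetaLine` (file `DivisibilityInputsZetaLine`) except
`D : W.SelmerDualData κ γ⁻¹`, `Y : W.FineSelmerDualData κ γ⁻¹`, `K : DivisibilityInputsContra …`
(composition of the two ports above). Proved.
[cite: Kato2004Asterisque, (14.9.3) (p. 240) and §17.13 (p. 279)] -/
theorem exists_divisibilityInputs_fineQuotient_contra_of_zetaLine
    (h : exists_divisibilityInputsZetaLine_fineQuotient_zeta_contra) :
    ∀ (W : WeierstrassCurve ℚ) [W.IsElliptic] [W.IsGloballyMinimal] (p : ℕ) [Fact p.Prime]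
      [ContinuousSMul ℤ_[p] (W.tateModule p)] [Module.Free ℤ_[p] (W.tateModule p)]
      [Module.Finite ℤ_[p] (W.tateModule p)] {N : ℕ} [NeZero N] (f : CuspForm (Gamma0 N) 2)
      (κ : ZpExtension ℚ p) (γ : absoluteGaloisGroup ℚ),
      p ≠ 2 → IsOrdinaryAt W p → κ.IsCyclotomic → κ.IsTopGenerator γ → IsCyclotomicVariable p γ →
      IsNewformOf W f →
      ∀ (I : IwasawaH1Data W p κ γ) (D : W.SelmerDualData κ γ⁻¹) (Y : W.FineSelmerDualData κ γ⁻¹),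
        ∃ (K : DivisibilityInputsContra W p f κ γ I D) (π : D.X →ₗ[IwasawaAlgebra p] Y.X),
          Function.Surjective π ∧ Function.Exact K.toX π :=
  exists_divisibilityInputs_fineQuotient_contra_of_zeta
    (exists_divisibilityInputs_fineQuotient_zeta_contra_of_zetaLine h)

/-! ## §2 The multiplicative package (twin of `MultDivisibilityInputs`) and its three facts (V′, VI′, XI′) -/

section MultPackage

variable (W : WeierstrassCurve ℚ) [W.IsElliptic] [W.IsGloballyMinimal] (p : ℕ) [Fact p.Prime]
  [ContinuousSMul ℤ_[p] (W.tateModule p)] (L : PowerSeries ℚ_[p])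
  (κ : ZpExtension ℚ p) (γ : absoluteGaloisGroup ℚ)
  (I : IwasawaH1Data W p κ γ) (D : W.SelmerDualData κ γ⁻¹)

/-- **Kato's §17.13 inputs at a MULTIPLICATIVE prime for the Mazur–Tate–Teitelbaum function `L` —
PRINT-EXACT twin of `Kato2004.MultDivisibilityInputs` (hypothesis structure; nothing asserted).** FIELD FOR
FIELD the sibling `MultDivisibilityInputs W p L κ γ I D` (its field docstrings apply verbatim: (12.2.1) +
Thm. 12.4 (1); (17.13.1) maps with the four «exact upto `×p^a`» clauses ((17.13.1) with 14.9, Greenberg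
LNM 1716 §2 at a non-split `2`); Prop. 17.11 / Lemma 17.12 at the Tate curve (Wuthrich 2014 p. 391;
Kobayashi 2006 Thm. 4.1); Thm. 12.6 (`Z`); 16.6 (2) (`pow_mem`); Thm. 12.5 (3) at `𝔭 ∌ p` in its printed
shape (`es_bound`, SAME `𝔭` both sides) and its second sentence (`lengthAt_H2loc_le_one`)), for
`I : IwasawaH1Data W p κ γ` (`T = conj_γ − 1`, covariant) and a dual Selmer datum
`D : W.SelmerDualData κ γ⁻¹` (contragredient `Λ`-structure: the one for which (17.13.1) is `Λ`-linear as
printed; flag `Kato-1713-dual-action`).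
[cite: Kato2004Asterisque, Thm. 12.4 (1) (p. 221), Thm. 12.5 (1)–(3) (pp. 221–222), Thm. 12.6 (p. 222), §16.1 and Thm. 16.6 (2) (pp. 268–271), Lemma 17.12 (p. 278), §17.3 (p. 273), §17.13 (17.13.1)–(17.13.3) (p. 279), 14.9 (p. 239)]
[cite: GreenbergLNM1716, §2 (multiplicative primes of the cyclotomic tower)]
[cite: Wuthrich2014, p. 391 (Coleman map at a multiplicative prime; odd p)]
[cite: Greenberg1989, §0 pp. 101–102 (S^ι)] -/
structure MultDivisibilityInputsContra where
  /-- `P = 𝐇¹_loc(T(k))/lim← H¹_f` ((17.13.3)), abstract. -/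
  P : Type
  /-- `H2 = 𝐇²(T(k))`, abstract. -/
  H2 : Type
  /-- `H2loc = 𝐇²_loc(T(k))`, abstract. -/
  H2loc : Type
  [addCommGroupP : AddCommGroup P]
  [moduleP : _root_.Module (IwasawaAlgebra p) P]
  [addCommGroupH2 : AddCommGroup H2]
  [moduleH2 : _root_.Module (IwasawaAlgebra p) H2]
  [addCommGroupH2loc : AddCommGroup H2loc]
  [moduleH2loc : _root_.Module (IwasawaAlgebra p) H2loc]
  /-- (12.2.1): `𝐇²` is a finitely generated `Λ`-module. -/
  finite_H2 : Module.Finite (IwasawaAlgebra p) H2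
  /-- Thm. 12.4 (1): `𝐇²` is a torsion `Λ`-module (no hypothesis on the reduction at `p`). -/
  isTorsion_H2 : Module.IsTorsion (IwasawaAlgebra p) H2
  /-- (17.13.1): `𝐇¹ → P`. -/
  loc : I.H →ₗ[IwasawaAlgebra p] P
  /-- (17.13.1): `P → 𝔛 = X(E/ℚ_∞)` (contragredient `Λ`-structure on the dual). -/
  toX : P →ₗ[IwasawaAlgebra p] D.X
  /-- (17.13.1): `𝔛 → 𝐇²`. -/
  δ : D.X →ₗ[IwasawaAlgebra p] H2
  /-- (17.13.1): `𝐇² → 𝐇²_loc`. -/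
  ε : H2 →ₗ[IwasawaAlgebra p] H2loc
  /-- The exponent of the Poitou–Tate defect ((17.13.1) «exact upto `×2` in the case `p = 2`», p. 279;
  14.9 p. 239; Greenberg's index `≤ 2` at a non-split `2`). -/
  a : ℕ
  /-- (17.13.1) at `P`, upto `×p^a`: `p^a · toX(loc 𝐇¹) = 0`. -/
  upTo_P : ∀ h : I.H, ((p : IwasawaAlgebra p) ^ a) • toX (loc h) = 0
  /-- (17.13.1) at `𝔛`, upto `×p^a`: `p^a · Ker δ ⊆ toX(P)`. -/
  upTo_X : ∀ x : D.X, δ x = 0 → ((p : IwasawaAlgebra p) ^ a) • x ∈ LinearMap.range toX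
  /-- (17.13.1) at `𝐇²`, upto `×p^a`: `p^a · ε(δ 𝔛) = 0`. -/
  upTo_H2 : ∀ x : D.X, ((p : IwasawaAlgebra p) ^ a) • ε (δ x) = 0
  /-- (14.9), the Poitou–Tate term after `𝐇²_loc`: `p^a · 𝐇²_loc ⊆ ε(𝐇²)`. -/
  upTo_H2loc : ∀ y : H2loc, ((p : IwasawaAlgebra p) ^ a) • y ∈ LinearMap.range ε
  /-- The Coleman / Perrin-Riou map on the singular quotient, `𝔏_η : P → Λ` (Thm. 16.4; Prop. 17.11 via
  Lemma 17.12 at the unramified quotient of the Tate curve). -/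
  col : P →ₗ[IwasawaAlgebra p] IwasawaAlgebra p
  /-- … which is INJECTIVE (Wuthrich 2014 p. 391 at a non-split, Kobayashi 2006 Thm. 4.1 at a split
  prime; odd `p`). -/
  col_injective : Function.Injective col
  /-- Thm. 12.6: the `Λ`-span `Z ⊂ 𝐇¹(T)` of the integral zeta elements (8.1.3)/(8.11). -/
  Z : Submodule (IwasawaAlgebra p) I.H
  /-- The `p`-power denominator of "`L_{p-adic} ∈ Λ ⊗ ℚ`" (Thm. 16.2; p. 279). -/
  n : ℕ
  /-- `G = pⁿ · L` as an element of `Λ`. -/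
  G : IwasawaAlgebra p
  /-- `ι G = pⁿ · L` in `ℚ_p⟦T⟧`. -/
  ιG_eq : iwasawaToPowerSeries p G = PowerSeries.C ((p : ℚ_[p]) ^ n) * L
  /-- Thm. 16.6 (2) (`α = a_p`, under §16.1 only) with 12.5 (1)(2) and 12.6: `G ∈ col(loc Z)`. -/
  pow_mem : G ∈ Submodule.map (col ∘ₗ loc) Z
  /-- Thm. 12.5 (3) at the height-one primes `𝔭 ∌ p`, PRINTED SHAPE (error term included), SAME `𝔭`:
  `length 𝐇²_𝔭 ≤ length (𝐇¹/Z)_𝔭 + length (𝐇²_loc)_𝔭`. -/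
  es_bound : ∀ 𝔭 : PrimeSpectrum (IwasawaAlgebra p), 𝔭.asIdeal.height = 1 →
    PowerSeries.C (p : ℤ_[p]) ∉ 𝔭.asIdeal →
      lengthAt (IwasawaAlgebra p) H2 𝔭 ≤
        lengthAt (IwasawaAlgebra p) (I.H ⧸ Z) 𝔭 + lengthAt (IwasawaAlgebra p) H2loc 𝔭
  /-- Thm. 12.5 (3), second sentence: at a height-one `𝔭 ∌ p`, `length (𝐇²_loc)_𝔭 ≤ 1`. -/
  lengthAt_H2loc_le_one : ∀ 𝔭 : PrimeSpectrum (IwasawaAlgebra p), 𝔭.asIdeal.height = 1 →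
    PowerSeries.C (p : ℤ_[p]) ∉ 𝔭.asIdeal → lengthAt (IwasawaAlgebra p) H2loc 𝔭 ≤ 1

attribute [instance] MultDivisibilityInputsContra.addCommGroupP MultDivisibilityInputsContra.moduleP
  MultDivisibilityInputsContra.addCommGroupH2 MultDivisibilityInputsContra.moduleH2
  MultDivisibilityInputsContra.addCommGroupH2loc MultDivisibilityInputsContra.moduleH2loc

end MultPackage

/-- **Kato 2004 at an ODD prime of NON-SPLIT multiplicative reduction: the §17.13 inputs EXIST for the
Mazur–Tate–Teitelbaum function (`α = a_p = −1`), dual in its CONTRAGREDIENT `Λ`-structure, with the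
`𝐇²_loc`-term of 12.5 (3) vanishing at every height-one `𝔭 ∌ p` (V′).** VERBATIM the sibling
`exists_multDivisibilityInputs_nonsplit` except `D : W.SelmerDualData κ γ⁻¹` and
`K : MultDivisibilityInputsContra …` (the `H2loc = 0` clause is a statement about `𝐇²_loc` alone). A
CONSTRUCTION fact — the PRINT-EXACT twin resolving reading flag `Kato-1713-dual-action` (the flag
and ARM-P R-48 stay on the γ-keyed sibling; this decl: VERBATIM · PRINT-EXACT · KERNEL-LOCKED against the sibling,
bsd-cited (658)/(668)); nothing asserted; no `_holds`.
[cite: Kato2004Asterisque, Thm. 12.4 (1) (p. 221), Thm. 12.5 (1)–(3) with (12.5.1) (pp. 221–222), Thm. 12.6 (p. 222), §13.13 (pp. 233–234), §16.1–16.6 (pp. 268–271), Prop. 17.11 and Lemma 17.12 (pp. 277–278), §17.3 (p. 273), §17.13 (pp. 279–280)]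
[cite: Wuthrich2014, p. 391 (Prop. 17.11 at a non-split multiplicative prime, odd p)]
[cite: GreenbergLNM1716, §2 (multiplicative v of the cyclotomic tower, Im κ = Im λ, p odd)]
[cite: Greenberg1989, §0 pp. 101–102 (S^ι)] -/
def exists_multDivisibilityInputs_nonsplit_contra : Prop :=
  ∀ (W : WeierstrassCurve ℚ) [W.IsElliptic] [W.IsGloballyMinimal] (p : ℕ) [Fact p.Prime]
    [ContinuousSMul ℤ_[p] (W.tateModule p)] {N : ℕ} [NeZero N] (f : CuspForm (Gamma0 N) 2)
    (κ : ZpExtension ℚ p) (γ : absoluteGaloisGroup ℚ),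
    p ≠ 2 → W.HasMultiplicativeReductionAtPrime p → ¬ W.HasSplitMultiplicativeReductionAtPrime p →
    κ.IsCyclotomic → κ.IsTopGenerator γ → IsCyclotomicVariable p γ → IsNewformOf W f →
    ∀ (L : PowerSeries ℚ_[p]), IsMultPAdicLFunctionOf f p (-1) L →
    ∀ (I : IwasawaH1Data W p κ γ) (D : W.SelmerDualData κ γ⁻¹),
      ∃ K : MultDivisibilityInputsContra W p L κ γ I D,
        ∀ 𝔭 : PrimeSpectrum (IwasawaAlgebra p), 𝔭.asIdeal.height = 1 →
          PowerSeries.C (p : ℤ_[p]) ∉ 𝔭.asIdeal → lengthAt (IwasawaAlgebra p) K.H2loc 𝔭 = 0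

/-- **Kato 2004 with Kobayashi 2006 Thm. 4.1 at an ODD prime of SPLIT multiplicative reduction: the §17.13
inputs EXIST for the Mazur–Tate–Teitelbaum function (`α = a_p = 1`), dual in its CONTRAGREDIENT
`Λ`-structure, with the Coleman map of the singular quotient valued in the augmentation ideal `(T)`
(VI′).** VERBATIM the sibling `exists_multDivisibilityInputs_split` except `D : W.SelmerDualData κ γ⁻¹`
and `K : MultDivisibilityInputsContra …` (the `col(P) ⊆ (T)` clause involves `P` and `Λ` only; `ι(T) = (T)`).
A CONSTRUCTION fact — the PRINT-EXACT twin resolving reading flag `Kato-1713-dual-action` (the flag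
and ARM-P R-48 stay on the γ-keyed sibling; this decl: VERBATIM · PRINT-EXACT · KERNEL-LOCKED against the sibling,
bsd-cited (658)/(668)); nothing asserted; no `_holds`.
[cite: Kato2004Asterisque, Thm. 12.4 (1) (p. 221), Thm. 12.5 (1)–(3) with (12.5.1) (pp. 221–222), Thm. 12.6 (p. 222), §16.1–16.6 (pp. 268–271), §17.3 (p. 273), §17.13 (pp. 279–280), Remark 18.3 (p. 281)]
[cite: Kobayashi2006DocMath, Thm. 4.1 (Coleman map of the Tate curve into I; odd p)]
[cite: Wuthrich2014, p. 391 and Cor. 19 (p. 398)] [cite: GreenbergLNM1716, §2]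
[cite: Greenberg1989, §0 pp. 101–102 (S^ι)] -/
def exists_multDivisibilityInputs_split_contra : Prop :=
  ∀ (W : WeierstrassCurve ℚ) [W.IsElliptic] [W.IsGloballyMinimal] (p : ℕ) [Fact p.Prime]
    [ContinuousSMul ℤ_[p] (W.tateModule p)] {N : ℕ} [NeZero N] (f : CuspForm (Gamma0 N) 2)
    (κ : ZpExtension ℚ p) (γ : absoluteGaloisGroup ℚ),
    p ≠ 2 → W.HasSplitMultiplicativeReductionAtPrime p →
    κ.IsCyclotomic → κ.IsTopGenerator γ → IsCyclotomicVariable p γ → IsNewformOf W f →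
    ∀ (L : PowerSeries ℚ_[p]), IsSplitMultPAdicLFunctionOf f p L →
    ∀ (I : IwasawaH1Data W p κ γ) (D : W.SelmerDualData κ γ⁻¹),
      ∃ K : MultDivisibilityInputsContra W p L κ γ I D,
        ∀ y : K.P, K.col y ∈ Ideal.span {(PowerSeries.X : IwasawaAlgebra p)}

/-- **Kato 2004 at an ODD prime of MULTIPLICATIVE reduction: the §17.13 package EXISTS for the
Mazur–Tate–Teitelbaum function TOGETHER WITH the complex clause `toX ∘ loc = 0`, a SURJECTIVE fine quotient
exact after `P → X`, the Thm. 12.6 span clause and, under `Irr(E[p])`, the p. 280 image clause in Kato's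
Néron normalisation — BOTH duals in their CONTRAGREDIENT `Λ`-structure (XI′).** VERBATIM the sibling
`exists_multDivisibilityInputs_fine` (cell `bsd-stepL`) except `D : W.SelmerDualData κ γ⁻¹`,
`Y : W.FineSelmerDualData κ γ⁻¹`, `K : MultDivisibilityInputsContra …`. A CONSTRUCTION fact — the
PRINT-EXACT twin resolving reading flag `Kato-1713-dual-action` (the flag and ARM-P R-48
stay on the γ-keyed sibling; this decl: VERBATIM · PRINT-EXACT · KERNEL-LOCKED against the sibling,
bsd-cited (658)/(668)); nothing asserted; no `_holds`.
[cite: Kato2004Asterisque, Thm. 12.4 (1) (p. 221), Thm. 12.5 (1)–(3) and Thm. 12.6 (pp. 221–222), Ex. 13.3 (p. 225), (14.9.3) (p. 240), §16.1 and Thm. 16.6 (2) (pp. 268–271), 17.5 (p. 274), Prop. 17.11 and Lemma 17.12 (pp. 277–278), §17.3 (p. 273), §17.13 (17.13.1)–(17.13.3) (p. 279) and p. 280]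
[cite: GreenbergLNM1716, §2] [cite: Wuthrich2014, p. 391] [cite: Kobayashi2006DocMath, Thm. 4.1]
[cite: MazurTateTeitelbaum1986, §I.10 and §I.14 (allowable root α = a_p at p ∥ N)]
[cite: Greenberg1989, §0 pp. 101–102 (S^ι)] -/
def exists_multDivisibilityInputs_fine_contra : Prop :=
  ∀ (W : WeierstrassCurve ℚ) [W.IsElliptic] [W.IsGloballyMinimal] (p : ℕ) [Fact p.Prime]
    [ContinuousSMul ℤ_[p] (W.tateModule p)] [Module.Free ℤ_[p] (W.tateModule p)]
    [Module.Finite ℤ_[p] (W.tateModule p)] {N : ℕ} [NeZero N] (f : CuspForm (Gamma0 N) 2)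
    (κ : ZpExtension ℚ p) (γ : absoluteGaloisGroup ℚ),
    p ≠ 2 → W.HasMultiplicativeReductionAtPrime p →
    κ.IsCyclotomic → κ.IsTopGenerator γ → IsCyclotomicVariable p γ → IsNewformOf W f →
    ∀ (a : ℚ_[p]) (L : PowerSeries ℚ_[p]),
      (W.HasSplitMultiplicativeReductionAtPrime p → a = 1) →
      (¬ W.HasSplitMultiplicativeReductionAtPrime p → a = -1) →
      IsMultPAdicLFunctionOf f p a L →
    ∀ (I : IwasawaH1Data W p κ γ) (D : W.SelmerDualData κ γ⁻¹) (Y : W.FineSelmerDualData κ γ⁻¹),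
      ∃ (K : MultDivisibilityInputsContra W p L κ γ I D) (π : D.X →ₗ[IwasawaAlgebra p] Y.X),
        (∀ h : I.H, K.toX (K.loc h) = 0) ∧
        Function.Surjective π ∧ Function.Exact K.toX π ∧
        K.Z ≤ Submodule.span (IwasawaAlgebra p) {s : I.H | IsEulerSystemClass W p κ γ I s} ∧
        (W.HasIrreducibleModPGaloisRep p →
          ∀ (G₁ : IwasawaAlgebra p) (ϖ : ℚ), (ϖ : ℝ) * W.realPeriodRat = plusPeriod f →
            iwasawaToPowerSeries p G₁ = PowerSeries.C ((ϖ : ℚ) : ℚ_[p]) * L →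
            ∀ 𝔭 : PrimeSpectrum (IwasawaAlgebra p), 𝔭.asIdeal.height = 1 →
              ∃ s : IwasawaAlgebra p, s ∉ 𝔭.asIdeal ∧
                s * G₁ ∈ Submodule.map (K.col ∘ₗ K.loc) K.Z ∧
                ∀ z ∈ K.Z, s * K.col (K.loc z) ∈ Ideal.span {G₁})

end Literature.NumberTheory.EllipticCurves.Kato2004

end
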